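import Literature.MathematicalPhysics.QuantumFieldTheory.Balaban1983to89.B8Ineq159FlatOfScalarBdry

/-!
# `Balaban1983to89.B8Ineq159Flat4OfScalarBdry` — [Balaban1985RegularSpaces] (1.59) p. 86 AT THE FLAT BACKGROUND, IN THE REPAIRED CURRENCY:
# the FOUR-line clause of Proposition 3's frame (`|A′|₍₋₁₎`, `|∇A′|₍₋₂₎`, `|J(A′)|₍₋₃₎`, `|ΔA′|₍₋₃₎`, collar allowance on each) for `𝔸`-valued
# exponents FOLLOWS from the scalar four-line clause — `⊗ id`, [4] p. 394

statement-level skeleton of published theorems with citation tags; proofs where landed; nothing here is a claim about the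
Yang–Mills mass gap

`[Balaban1985RegularSpaces]` CMP **99** (1985): (1.59) p. 86, (1.58) p. 86, Prop. 3 p. 87, (1.36)–(1.38) p. 82, p. 86 (norms), p. 77 (bond
convention); [4] = `[Balaban1985BackgroundPropagators]` Thm 3.3 p. 399, (3.47) p. 398, (3.23) p. 394, p. 394 («⊗ identity»).

CITATION HEADER (lean-in-tree rule).  Cell `pub-ymgap` (D-0062), node N05 = [B8], seat `pub-ymgap-dag-n05-e` g7 (R141 (C) row s3b — the FLAT
LINE for Proposition 6 in the repaired currency).  WHY: after `B8Prop6CubeMemberFlatScalarBdry.prop6_cubeMember_flat_of_scalar_bdry` the only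
gauge-field hypothesis left in the flat line's knit letter (`B8Prop6CubeMemberGaugedRealBdry`) is the flat FOUR-LINE Prop.-3-frame socket at
background `1` (the (1.136) norm members' input).  THIS FILE reduces it, too, to a SCALAR clause: ★ `flat159_clause4_of_scalar_bdry` — the
four-line transfer (g5's two-line `⊗ id` argument + the current and Laplacian members, which commute with every continuous functional by
`B8Ineq159FlatMaps`).  Kind «kernel-checked proof», theorems only, no `def`.

HONEST SCOPE.  Nothing of [4] Thm 3.3 is proved: the scalar flat four-line clause with exterior data is the displayed HYPOTHESIS (not certified
false: the corner mode satisfies it for `B_∂ ≥ 1`; the third line is a-priori bookkeeping since the tree's `Jcur` is `pdiv ∘ plaqCovDeriv`);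
`B_∂ ≥ 0` is the tree's.  Count-neutral; N05 NOT discharged; one finite `𝕋⁴` programme at fixed `ε`, Bałaban as printed; nothing continuum ∕ ℝ⁴ ∕
OS ∕ mass-gap ∕ Clay.  No `sorry`, no `def`, no `instance`, no `notation`.  Unit `pub-ymgap-dag-n05-e` (g7), 2026-08-27.
-/

noncomputable section

namespace Literature.MathematicalPhysics.QuantumFieldTheory.Balaban1983to89.B8Ineq159Flat4OfScalarBdry

open NormedSpace Finset
open Complex (I I_ne_zero)
open B7Prop1Explicit (e expUnit val_expUnit asum_seg_natCast boxVec seg)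
open B7Eq78Linearization (conjR conjR_apply)
open B8Ineq132 (covDeriv covDerivFwd BondTouches)
open B8Eq143PlaqExpansion (pdiv)
open B8Eq146AExpansion (plaqCovDeriv plaqCovDeriv_eq_covDerivFwd iEta)
open B8Eq155JBound (Jcur wsup wsup_le le_wsup wsup_nonneg)
open B8ScaledSupNorm (weight msup Bdd bondNorm msup_le msup_nonneg weight_mul_norm_le_msup weight_neg_natCast weight_pos)
open B8Eq138LandauZd (covDivB covLap QT IsLandau138 IsLandau138W logCfg isLandau138_congr)
open B8Eq184Proof (cfgExp)
open B8Eq140Level (SideTouches sideTouches_of_bondTouches)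
open B7Prop4GeneralLevels (linCovIter)
open B7Prop3Flat (linQ)
open B7Prop4Flat (linQIter linQIter_zero linQIter_succ norm_linQIter_le)
open B9Eq316TowerFlatIsOneStep (linCovIter_one_left)
open B8Eq191FlatStencils (covDerivFwd_flat_apply covDeriv_flat_apply covLap_flat_apply QT_flat_apply)
open B7BlockAvgLog (mlog_exp)
open MatrixLog (mlog)

export B7Prop1Explicit (Site)

variable {d : ℕ}
open B8Ineq159FlatMaps (map_covDerivFwd_flat map_Jcur_flat map_covLap_flat isLandau138_map_flat map_linCovIter_flat logCfg_eq_of_cfgExp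
  norm_covDerivFwd_flat_le norm_Jcur_flat_le)
/-! ## ★ The FOUR-line (1.59) clause (Prop. 3's frame) WITH THE EXTERIOR-COLLAR ALLOWANCE at background `1`, from the scalar flat clause -/

section Transfer

variable {𝔸 : Type*} [NormedRing 𝔸] [NormedAlgebra ℂ 𝔸] [CompleteSpace 𝔸] [NormOneClass 𝔸]

/-- ★ **THE FOUR-LINE (1.59) CLAUSE OF PROPOSITION 3's FRAME AT THE FLAT BACKGROUND IN THE REPAIRED CURRENCY, `⊗ id`: FOR `𝔸`-VALUED
EXPONENTS IT FOLLOWS FROM THE SCALAR FLAT FOUR-LINE CLAUSE.**  `B8Ineq159FlatOfScalarBdry.flat159_clause_of_scalar_bdry` (this seat) with TWO MORE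
members on both sides: the current `|J(·)|₍₋₃₎ = |D^{η*}_1D^η_1 ·|₍₋₃₎` (the tree's `pdiv ∘ plaqCovDeriv`, which IS `Jcur` — this line of the
tree's socket is a-priori bookkeeping) and the flat Laplacian of the components `|Δ^η_1 ·|₍₋₃₎`, each `≤ B₀(|J|₍₋₃₎ + |B₁|) + B_∂Φ₀` — i.e. EXACTLY
the body of the flat FOUR-LINE Prop.-3-frame socket at background `1` (`B8Prop6CubeMemberNormsFlatBdry4`'s binder, at the top truncation `m = k`,
`Λs := Λs k`, `Λb := Λb k`) after `W`'s unitarity, the two `𝔄`-memberships and self-adjointness.  HYPOTHESIS `SCALAR` = the same four lines for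
every `ℂ`-valued flat-Landau bond function vanishing off the collars ([4] Thm 3.3 at `U = 1` for `G(1)`, `H(1)` on a finite region WITH exterior
data, a-priori form, abelian).  PROOF: g5's transfer verbatim for the first two members; for the new two, `φ` commutes with the flat current and
the flat Laplacian (`B8Ineq159FlatMaps.map_Jcur_flat`, `map_covLap_flat`), the `Bdd` side conditions come from the displayed smallness
(`‖Δ^η_1A′‖ ≤ 4d·c·η⁻³` by the five-point stencil `covLap_flat_apply`), and Hahn–Banach returns the members for `A′`.
[cite: Balaban1985RegularSpaces, (1.59) p.86, (1.58) p.86, Prop. 3 p.87, (1.36)–(1.38) p.82, p.77; Balaban1985BackgroundPropagators, Thm 3.3 p.399, (3.47) p.398, (3.23) p.394, p.394 («⊗ identity»)] -/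
theorem flat159_clause4_of_scalar_bdry (hd2 : 2 ≤ d) {L : ℕ} (hL : 1 ≤ L) {η : ℝ} (hη : 0 < η) (m : ℕ)
    (Ω : ℕ → Set (Site d)) (Λs : ℕ → Set (Site d)) (Λb : ℕ → Set (Site d × Fin d)) {B₀ Bbd c : ℝ} (hB₀ : 0 ≤ B₀) (hBbd : 0 ≤ Bbd)
    (hc0 : 0 ≤ c) (hc : c ≤ 1 / 2)
    (SCALAR : ∀ a : Site d → Fin d → ℂ,
      IsLandau138 L m η (Ω 0) Λs (1 : Site d → Fin d → ℂˣ) a →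
      (∀ (y : Site d) (τ : Fin d), (∀ j, j ≤ m → ¬ SideTouches (Ω j) y τ) → a y τ = 0) →
      msup L m η (-(1 : ℝ)) (fun j (b : Site d × Fin d) => SideTouches (Ω j) b.1 b.2) (fun b => a b.1 b.2)
          ≤ B₀ * (bondNorm L m η (-(3 : ℝ)) Ω (fun x μ => Jcur η (1 : Site d → Fin d → ℂˣ) a μ x)
            + wsup 1 (fun p : {p : ℕ × (Site d × Fin d) // p.1 ≤ m ∧ p.2 ∈ Λb p.1} =>
                linCovIter L (1 : Site d → Fin d → ℂˣ) (iEta η a) p.1.1 p.1.2.1 p.1.2.2)) + Bbd * msup L m η (-(1 : ℝ)) (fun j (b : Site d × Fin d) => j = 0 ∧ SideTouches (Ω 0) b.1 b.2 ∧ ¬ BondTouches (Ω 0) b.1 b.2)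
                (fun b => a b.1 b.2) ∧
        msup L m η (-(2 : ℝ)) (fun j (t : Fin d × Fin d × Site d) => SideTouches (Ω j) t.2.2 t.2.1)
            (fun t => covDerivFwd η (1 : Site d → Fin d → ℂˣ) t.1 (fun z => a z t.2.1) t.2.2)
          ≤ B₀ * (bondNorm L m η (-(3 : ℝ)) Ω (fun x μ => Jcur η (1 : Site d → Fin d → ℂˣ) a μ x)
            + wsup 1 (fun p : {p : ℕ × (Site d × Fin d) // p.1 ≤ m ∧ p.2 ∈ Λb p.1} =>
                linCovIter L (1 : Site d → Fin d → ℂˣ) (iEta η a) p.1.1 p.1.2.1 p.1.2.2)) + Bbd * msup L m η (-(1 : ℝ)) (fun j (b : Site d × Fin d) => j = 0 ∧ SideTouches (Ω 0) b.1 b.2 ∧ ¬ BondTouches (Ω 0) b.1 b.2)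
                (fun b => a b.1 b.2) ∧
        bondNorm L m η (-(3 : ℝ)) Ω (fun x μ => pdiv η (1 : Site d → Fin d → ℂˣ) (plaqCovDeriv η (1 : Site d → Fin d → ℂˣ) a) μ x)
          ≤ B₀ * (bondNorm L m η (-(3 : ℝ)) Ω (fun x μ => Jcur η (1 : Site d → Fin d → ℂˣ) a μ x)
            + wsup 1 (fun p : {p : ℕ × (Site d × Fin d) // p.1 ≤ m ∧ p.2 ∈ Λb p.1} =>
                linCovIter L (1 : Site d → Fin d → ℂˣ) (iEta η a) p.1.1 p.1.2.1 p.1.2.2)) + Bbd * msup L m η (-(1 : ℝ)) (fun j (b : Site d × Fin d) => j = 0 ∧ SideTouches (Ω 0) b.1 b.2 ∧ ¬ BondTouches (Ω 0) b.1 b.2)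
                (fun b => a b.1 b.2) ∧
        bondNorm L m η (-(3 : ℝ)) Ω (fun x μ => covLap η (1 : Site d → Fin d → ℂˣ) (fun z => a z μ) x)
          ≤ B₀ * (bondNorm L m η (-(3 : ℝ)) Ω (fun x μ => Jcur η (1 : Site d → Fin d → ℂˣ) a μ x)
            + wsup 1 (fun p : {p : ℕ × (Site d × Fin d) // p.1 ≤ m ∧ p.2 ∈ Λb p.1} =>
                linCovIter L (1 : Site d → Fin d → ℂˣ) (iEta η a) p.1.1 p.1.2.1 p.1.2.2)) + Bbd * msup L m η (-(1 : ℝ)) (fun j (b : Site d × Fin d) => j = 0 ∧ SideTouches (Ω 0) b.1 b.2 ∧ ¬ BondTouches (Ω 0) b.1 b.2)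
                (fun b => a b.1 b.2))
    (W : Site d → Fin d → 𝔸ˣ) (A' : Site d → Fin d → 𝔸)
    (hLan : IsLandau138W L m η (Ω 0) Λs (1 : Site d → Fin d → 𝔸ˣ) W)
    (hWA : ∀ j, j ≤ m → ∀ (y : Site d) (τ : Fin d), SideTouches (Ω j) y τ →
      W y τ = cfgExp η A' y τ ∧ ‖A' y τ‖ ≤ c * ((L : ℝ) ^ j * η)⁻¹)
    (hA0 : ∀ (y : Site d) (τ : Fin d), (∀ j, j ≤ m → ¬ SideTouches (Ω j) y τ) → A' y τ = 0) :
    msup L m η (-(1 : ℝ)) (fun j (b : Site d × Fin d) => SideTouches (Ω j) b.1 b.2) (fun b => A' b.1 b.2)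
        ≤ B₀ * (bondNorm L m η (-(3 : ℝ)) Ω (fun x μ => Jcur η (1 : Site d → Fin d → 𝔸ˣ) A' μ x)
          + wsup 1 (fun p : {p : ℕ × (Site d × Fin d) // p.1 ≤ m ∧ p.2 ∈ Λb p.1} =>
              linCovIter L (1 : Site d → Fin d → 𝔸ˣ) (iEta η A') p.1.1 p.1.2.1 p.1.2.2)) + Bbd * msup L m η (-(1 : ℝ)) (fun j (b : Site d × Fin d) => j = 0 ∧ SideTouches (Ω 0) b.1 b.2 ∧ ¬ BondTouches (Ω 0) b.1 b.2)
              (fun b => A' b.1 b.2) ∧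
      msup L m η (-(2 : ℝ)) (fun j (t : Fin d × Fin d × Site d) => SideTouches (Ω j) t.2.2 t.2.1)
          (fun t => covDerivFwd η (1 : Site d → Fin d → 𝔸ˣ) t.1 (fun z => A' z t.2.1) t.2.2)
        ≤ B₀ * (bondNorm L m η (-(3 : ℝ)) Ω (fun x μ => Jcur η (1 : Site d → Fin d → 𝔸ˣ) A' μ x)
          + wsup 1 (fun p : {p : ℕ × (Site d × Fin d) // p.1 ≤ m ∧ p.2 ∈ Λb p.1} =>
              linCovIter L (1 : Site d → Fin d → 𝔸ˣ) (iEta η A') p.1.1 p.1.2.1 p.1.2.2)) + Bbd * msup L m η (-(1 : ℝ)) (fun j (b : Site d × Fin d) => j = 0 ∧ SideTouches (Ω 0) b.1 b.2 ∧ ¬ BondTouches (Ω 0) b.1 b.2)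
              (fun b => A' b.1 b.2) ∧
      bondNorm L m η (-(3 : ℝ)) Ω (fun x μ => pdiv η (1 : Site d → Fin d → 𝔸ˣ) (plaqCovDeriv η (1 : Site d → Fin d → 𝔸ˣ) A') μ x)
        ≤ B₀ * (bondNorm L m η (-(3 : ℝ)) Ω (fun x μ => Jcur η (1 : Site d → Fin d → 𝔸ˣ) A' μ x)
          + wsup 1 (fun p : {p : ℕ × (Site d × Fin d) // p.1 ≤ m ∧ p.2 ∈ Λb p.1} =>
              linCovIter L (1 : Site d → Fin d → 𝔸ˣ) (iEta η A') p.1.1 p.1.2.1 p.1.2.2)) + Bbd * msup L m η (-(1 : ℝ)) (fun j (b : Site d × Fin d) => j = 0 ∧ SideTouches (Ω 0) b.1 b.2 ∧ ¬ BondTouches (Ω 0) b.1 b.2)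
              (fun b => A' b.1 b.2) ∧
      bondNorm L m η (-(3 : ℝ)) Ω (fun x μ => covLap η (1 : Site d → Fin d → 𝔸ˣ) (fun z => A' z μ) x)
        ≤ B₀ * (bondNorm L m η (-(3 : ℝ)) Ω (fun x μ => Jcur η (1 : Site d → Fin d → 𝔸ˣ) A' μ x)
          + wsup 1 (fun p : {p : ℕ × (Site d × Fin d) // p.1 ≤ m ∧ p.2 ∈ Λb p.1} =>
              linCovIter L (1 : Site d → Fin d → 𝔸ˣ) (iEta η A') p.1.1 p.1.2.1 p.1.2.2)) + Bbd * msup L m η (-(1 : ℝ)) (fun j (b : Site d × Fin d) => j = 0 ∧ SideTouches (Ω 0) b.1 b.2 ∧ ¬ BondTouches (Ω 0) b.1 b.2)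
              (fun b => A' b.1 b.2) := by
  -- abbreviations for the two right-hand members of `A′`
  obtain ⟨XA, hXA⟩ : ∃ XA : ℝ, XA = bondNorm L m η (-(3 : ℝ)) Ω (fun x μ => Jcur η (1 : Site d → Fin d → 𝔸ˣ) A' μ x) := ⟨_, rfl⟩
  obtain ⟨YA, hYA⟩ : ∃ YA : ℝ, YA = wsup 1 (fun p : {p : ℕ × (Site d × Fin d) // p.1 ≤ m ∧ p.2 ∈ Λb p.1} =>
      linCovIter L (1 : Site d → Fin d → 𝔸ˣ) (iEta η A') p.1.1 p.1.2.1 p.1.2.2) := ⟨_, rfl⟩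
  obtain ⟨ZA, hZA⟩ : ∃ ZA : ℝ, ZA = msup L m η (-(1 : ℝ)) (fun j (b : Site d × Fin d) => j = 0 ∧ SideTouches (Ω 0) b.1 b.2 ∧ ¬ BondTouches (Ω 0) b.1 b.2)
      (fun b => A' b.1 b.2) := ⟨_, rfl⟩
  rw [← hXA, ← hYA, ← hZA]
  have hL0 : (0 : ℝ) < L := by exact_mod_cast hL
  have hL1 : (1 : ℝ) ≤ L := by exact_mod_cast hL
  have hLj : ∀ j : ℕ, (1 : ℝ) ≤ (L : ℝ) ^ j := fun j => one_le_pow₀ hL1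
  have hXA0 : 0 ≤ XA := by rw [hXA]; exact msup_nonneg L m hη.le _ _ _
  have hYA0 : 0 ≤ YA := by rw [hYA]; exact wsup_nonneg zero_le_one _
  have hZA0 : 0 ≤ ZA := by rw [hZA]; exact msup_nonneg L m hη.le _ _ _
  -- the full right-hand constant: the two (1.59) members + the exterior-collar allowance
  obtain ⟨K, hK⟩ : ∃ K : ℝ, K = B₀ * (XA + YA) + Bbd * ZA := ⟨_, rfl⟩
  have hK0 : 0 ≤ K := by rw [hK]; positivity
  -- two distinct directions (`d ≥ 2`): every bond is the side of a plaquette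
  have hex : ∀ τ : Fin d, ∃ κ : Fin d, κ ≠ τ := by
    intro τ
    by_cases h : τ = ⟨0, by omega⟩
    · refine ⟨⟨1, by omega⟩, fun h' => ?_⟩
      rw [h] at h'
      exact absurd (Fin.mk.inj_iff.mp h') (by norm_num)
    · exact ⟨⟨0, by omega⟩, fun h' => h h'.symm⟩
  -- Step 1: the uniform bound `‖A′‖ ≤ cη⁻¹`
  have hinvle : ∀ j : ℕ, ((L : ℝ) ^ j * η)⁻¹ ≤ η⁻¹ := fun j =>
    inv_anti₀ hη (le_mul_of_one_le_left hη.le (hLj j))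
  have hbd : ∀ (y : Site d) (τ : Fin d), ‖A' y τ‖ ≤ c * η⁻¹ := by
    intro y τ
    by_cases h : ∃ j, j ≤ m ∧ SideTouches (Ω j) y τ
    · obtain ⟨j, hj, hs⟩ := h
      exact ((hWA j hj y τ hs).2).trans (mul_le_mul_of_nonneg_left (hinvle j) hc0)
    · simp only [not_exists, not_and] at h
      rw [hA0 y τ fun j hj hs => h j hj hs, norm_zero]
      positivity
  -- Step 2: on the bonds touching `Ω 0` the exponent of record is `A′`, so `A′` is in the flat Landau gauge
  have hlog : ∀ (x : Site d) (μ : Fin d), BondTouches (Ω 0) x μ → logCfg η W x μ = A' x μ := by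
    intro x μ hb
    obtain ⟨κ, hκ⟩ := hex μ
    obtain ⟨hW, hsm⟩ := hWA 0 (Nat.zero_le _) x μ (sideTouches_of_bondTouches hκ hb)
    refine logCfg_eq_of_cfgExp hη hW ?_
    rw [pow_zero, one_mul] at hsm
    calc η * ‖A' x μ‖ ≤ η * (c * η⁻¹) := mul_le_mul_of_nonneg_left hsm hη.le
      _ = c := by field_simp
      _ ≤ 1 / 2 := hc
  have hLanA : IsLandau138 L m η (Ω 0) Λs (1 : Site d → Fin d → 𝔸ˣ) A' :=
    (isLandau138_congr η L (1 : Site d → Fin d → 𝔸ˣ) hlog).mp hLan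
  -- Step 3: the `Bdd` side conditions of `A′`'s right-hand families
  have hw3 : ∀ j : ℕ, weight L η (-(3 : ℝ)) j = ((L : ℝ) ^ j * η) ^ 3 := fun j => by
    simpa using weight_neg_natCast L η 3 j
  have hw2 : ∀ j : ℕ, weight L η (-(2 : ℝ)) j = ((L : ℝ) ^ j * η) ^ 2 := fun j => by
    simpa using weight_neg_natCast L η 2 j
  have hw1 : ∀ j : ℕ, weight L η (-(1 : ℝ)) j = (L : ℝ) ^ j * η := fun j => by
    simpa using weight_neg_natCast L η 1 j
  have hscale : ∀ j, j ≤ m → (L : ℝ) ^ j * η ≤ (L : ℝ) ^ m * η := fun j hj =>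
    mul_le_mul_of_nonneg_right (pow_le_pow_right₀ hL1 hj) hη.le
  have hscale0 : ∀ j : ℕ, 0 ≤ (L : ℝ) ^ j * η := fun j => by positivity
  obtain ⟨J₀, hJ₀⟩ : ∃ J₀ : ℝ, J₀ =
      (d : ℝ) * (η⁻¹ * ((η⁻¹ * (c * η⁻¹ + c * η⁻¹) + η⁻¹ * (c * η⁻¹ + c * η⁻¹)) +
        (η⁻¹ * (c * η⁻¹ + c * η⁻¹) + η⁻¹ * (c * η⁻¹ + c * η⁻¹)))) +
      (d : ℝ) * (η⁻¹ * ((η⁻¹ * (c * η⁻¹ + c * η⁻¹) + η⁻¹ * (c * η⁻¹ + c * η⁻¹)) +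
        (η⁻¹ * (c * η⁻¹ + c * η⁻¹) + η⁻¹ * (c * η⁻¹ + c * η⁻¹)))) := ⟨_, rfl⟩
  have hJ₀0 : 0 ≤ J₀ := by rw [hJ₀]; positivity
  have hJbd : ∀ (μ : Fin d) (x : Site d), ‖Jcur η (1 : Site d → Fin d → 𝔸ˣ) A' μ x‖ ≤ J₀ := fun μ x => by
    rw [hJ₀]; exact norm_Jcur_flat_le hη (by positivity) hbd μ x
  have hBddJ : Bdd L m η (-(3 : ℝ)) (fun j (b : Site d × Fin d) => BondTouches (Ω j) b.1 b.2)
      (fun b => Jcur η (1 : Site d → Fin d → 𝔸ˣ) A' b.2 b.1) := by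
    refine ⟨((L : ℝ) ^ m * η) ^ 3 * J₀, fun j hj b _ => ?_⟩
    rw [hw3]
    exact mul_le_mul (pow_le_pow_left₀ (hscale0 j) (hscale j hj) 3) (hJbd _ _) (norm_nonneg _) (by positivity)
  have hiEta : ∀ (y : Site d) (κ : Fin d), ‖iEta η A' y κ‖ ≤ c := fun y κ =>
    (B8Eq146AExpansion.norm_iEta_le hη.le hbd y κ).trans (le_of_eq (by field_simp))
  have hQbd : ∀ p : {p : ℕ × (Site d × Fin d) // p.1 ≤ m ∧ p.2 ∈ Λb p.1},
      1 * ‖linCovIter L (1 : Site d → Fin d → 𝔸ˣ) (iEta η A') p.1.1 p.1.2.1 p.1.2.2‖ ≤ (L : ℝ) ^ m * c := by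
    intro p
    rw [one_mul, linCovIter_one_left L hL _ hc0 hiEta p.1.1]
    exact (norm_linQIter_le L hL _ hc0 hiEta p.1.1 p.1.2.1 p.1.2.2).trans
      (mul_le_mul_of_nonneg_right (pow_le_pow_right₀ hL1 p.2.1) hc0)
  -- Step 4: for every functional `f`, the scalar clause at `a_f = f ∘ A′` bounds `f`'s view of both members by `‖f‖·B₀(XA + YA)`
  have hf : ∀ f : StrongDual ℂ 𝔸,
      msup L m η (-(1 : ℝ)) (fun j (b : Site d × Fin d) => SideTouches (Ω j) b.1 b.2) (fun b => f (A' b.1 b.2))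
          ≤ ‖f‖ * K ∧
        msup L m η (-(2 : ℝ)) (fun j (t : Fin d × Fin d × Site d) => SideTouches (Ω j) t.2.2 t.2.1)
            (fun t => covDerivFwd η (1 : Site d → Fin d → ℂˣ) t.1 (fun z => f (A' z t.2.1)) t.2.2)
          ≤ ‖f‖ * K ∧
        bondNorm L m η (-(3 : ℝ)) Ω (fun x μ => pdiv η (1 : Site d → Fin d → ℂˣ)
            (plaqCovDeriv η (1 : Site d → Fin d → ℂˣ) (fun y τ => f (A' y τ))) μ x) ≤ ‖f‖ * K ∧
        bondNorm L m η (-(3 : ℝ)) Ω (fun x μ => covLap η (1 : Site d → Fin d → ℂˣ) (fun z => f (A' z μ)) x) ≤ ‖f‖ * K := by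
    intro f
    obtain ⟨h1, h2, h3, h4⟩ := SCALAR (fun y τ => f (A' y τ)) (isLandau138_map_flat f hLanA)
      (fun y τ h => by simp only [hA0 y τ h, map_zero])
    -- the two right-hand members of `a_f` against those of `A′`
    have hX : bondNorm L m η (-(3 : ℝ)) Ω (fun x μ => Jcur η (1 : Site d → Fin d → ℂˣ) (fun y τ => f (A' y τ)) μ x)
        ≤ ‖f‖ * XA := by
      refine msup_le (by positivity) fun j hj b hb => ?_
      have hJ : Jcur η (1 : Site d → Fin d → ℂˣ) (fun y τ => f (A' y τ)) b.2 b.1 =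
          f (Jcur η (1 : Site d → Fin d → 𝔸ˣ) A' b.2 b.1) := (map_Jcur_flat f η A' b.2 b.1).symm
      have hw0 : 0 ≤ weight L η (-(3 : ℝ)) j := B8ScaledSupNorm.weight_nonneg L hη.le _ j
      calc weight L η (-(3 : ℝ)) j * ‖Jcur η (1 : Site d → Fin d → ℂˣ) (fun y τ => f (A' y τ)) b.2 b.1‖
          ≤ weight L η (-(3 : ℝ)) j * (‖f‖ * ‖Jcur η (1 : Site d → Fin d → 𝔸ˣ) A' b.2 b.1‖) := by
            rw [hJ]; exact mul_le_mul_of_nonneg_left (f.le_opNorm _) hw0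
        _ = ‖f‖ * (weight L η (-(3 : ℝ)) j * ‖Jcur η (1 : Site d → Fin d → 𝔸ˣ) A' b.2 b.1‖) := by ring
        _ ≤ ‖f‖ * XA := by
            rw [hXA]; exact mul_le_mul_of_nonneg_left (weight_mul_norm_le_msup hBddJ hj hb) (norm_nonneg _)
    have hY : wsup 1 (fun p : {p : ℕ × (Site d × Fin d) // p.1 ≤ m ∧ p.2 ∈ Λb p.1} =>
        linCovIter L (1 : Site d → Fin d → ℂˣ) (iEta η (fun y τ => f (A' y τ))) p.1.1 p.1.2.1 p.1.2.2) ≤ ‖f‖ * YA := by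
      refine wsup_le (fun p => ?_) (by positivity)
      have hfun : (fun w ν => f (iEta η A' w ν)) = iEta η (fun y τ => f (A' y τ)) := by
        funext w ν
        simp only [iEta, map_smul, smul_eq_mul]
      have hQ : linCovIter L (1 : Site d → Fin d → ℂˣ) (iEta η (fun y τ => f (A' y τ))) p.1.1 p.1.2.1 p.1.2.2 =
          f (linCovIter L (1 : Site d → Fin d → 𝔸ˣ) (iEta η A') p.1.1 p.1.2.1 p.1.2.2) := by
        rw [← hfun]; exact (map_linCovIter_flat f hL (iEta η A') hc0 hiEta _ _ _).symm
      calc 1 * ‖linCovIter L (1 : Site d → Fin d → ℂˣ) (iEta η (fun y τ => f (A' y τ))) p.1.1 p.1.2.1 p.1.2.2‖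
          ≤ ‖f‖ * (1 * ‖linCovIter L (1 : Site d → Fin d → 𝔸ˣ) (iEta η A') p.1.1 p.1.2.1 p.1.2.2‖) := by
            rw [hQ, one_mul, one_mul]; exact f.le_opNorm _
        _ ≤ ‖f‖ * YA := by rw [hYA]; exact mul_le_mul_of_nonneg_left (le_wsup hQbd p) (norm_nonneg _)
    -- the exterior-collar member of `a_f` against that of `A′`
    have hZ : msup L m η (-(1 : ℝ)) (fun j (b : Site d × Fin d) => j = 0 ∧ SideTouches (Ω 0) b.1 b.2 ∧ ¬ BondTouches (Ω 0) b.1 b.2)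
        (fun b => f (A' b.1 b.2)) ≤ ‖f‖ * ZA := by
      refine msup_le (by positivity) fun j hj b hb => ?_
      have hw0 : 0 ≤ weight L η (-(1 : ℝ)) j := B8ScaledSupNorm.weight_nonneg L hη.le _ j
      have hBddZ : Bdd L m η (-(1 : ℝ)) (fun j (b : Site d × Fin d) => j = 0 ∧ SideTouches (Ω 0) b.1 b.2 ∧ ¬ BondTouches (Ω 0) b.1 b.2)
          (fun b => A' b.1 b.2) := by
        refine ⟨(L : ℝ) ^ m * η * (c * η⁻¹), fun j' hj' b' _ => ?_⟩
        rw [hw1]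
        exact mul_le_mul (hscale j' hj') (hbd b'.1 b'.2) (norm_nonneg _) (hscale0 m)
      calc weight L η (-(1 : ℝ)) j * ‖f (A' b.1 b.2)‖
          ≤ weight L η (-(1 : ℝ)) j * (‖f‖ * ‖A' b.1 b.2‖) := mul_le_mul_of_nonneg_left (f.le_opNorm _) hw0
        _ = ‖f‖ * (weight L η (-(1 : ℝ)) j * ‖A' b.1 b.2‖) := by ring
        _ ≤ ‖f‖ * ZA := by
            rw [hZA]; exact mul_le_mul_of_nonneg_left (weight_mul_norm_le_msup hBddZ hj hb) (norm_nonneg _)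
    have hR : B₀ * (bondNorm L m η (-(3 : ℝ)) Ω (fun x μ => Jcur η (1 : Site d → Fin d → ℂˣ) (fun y τ => f (A' y τ)) μ x)
        + wsup 1 (fun p : {p : ℕ × (Site d × Fin d) // p.1 ≤ m ∧ p.2 ∈ Λb p.1} =>
            linCovIter L (1 : Site d → Fin d → ℂˣ) (iEta η (fun y τ => f (A' y τ))) p.1.1 p.1.2.1 p.1.2.2))
        + Bbd * msup L m η (-(1 : ℝ)) (fun j (b : Site d × Fin d) => j = 0 ∧ SideTouches (Ω 0) b.1 b.2 ∧ ¬ BondTouches (Ω 0) b.1 b.2)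
            (fun b => f (A' b.1 b.2))
        ≤ ‖f‖ * K := by
      calc B₀ * (bondNorm L m η (-(3 : ℝ)) Ω (fun x μ => Jcur η (1 : Site d → Fin d → ℂˣ) (fun y τ => f (A' y τ)) μ x)
            + wsup 1 (fun p : {p : ℕ × (Site d × Fin d) // p.1 ≤ m ∧ p.2 ∈ Λb p.1} =>
              linCovIter L (1 : Site d → Fin d → ℂˣ) (iEta η (fun y τ => f (A' y τ))) p.1.1 p.1.2.1 p.1.2.2))
            + Bbd * msup L m η (-(1 : ℝ)) (fun j (b : Site d × Fin d) => j = 0 ∧ SideTouches (Ω 0) b.1 b.2 ∧ ¬ BondTouches (Ω 0) b.1 b.2)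
              (fun b => f (A' b.1 b.2))
          ≤ B₀ * (‖f‖ * XA + ‖f‖ * YA) + Bbd * (‖f‖ * ZA) :=
            add_le_add (mul_le_mul_of_nonneg_left (add_le_add hX hY) hB₀) (mul_le_mul_of_nonneg_left hZ hBbd)
        _ = ‖f‖ * K := by rw [hK]; ring
    exact ⟨h1.trans hR, h2.trans hR, h3.trans hR, h4.trans hR⟩
  -- a uniform bound for the flat Laplacian of the components of `A′` (five-point stencil)
  have hLap : ∀ (μ : Fin d) (x : Site d), ‖covLap η (1 : Site d → Fin d → 𝔸ˣ) (fun z => A' z μ) x‖ ≤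
      (d : ℝ) * ((η ^ 2)⁻¹ * (2 * (c * η⁻¹) + c * η⁻¹ + c * η⁻¹)) := by
    intro μ x
    rw [covLap_flat_apply]
    refine (norm_sum_le _ _).trans ?_
    have hterm : ∀ ν ∈ (Finset.univ : Finset (Fin d)),
        ‖(η ^ 2)⁻¹ • ((2 : ℝ) • A' x μ - A' (x + e ν) μ - A' (x - e ν) μ)‖ ≤ (η ^ 2)⁻¹ * (2 * (c * η⁻¹) + c * η⁻¹ + c * η⁻¹) := by
      intro ν _
      rw [norm_smul, Real.norm_of_nonneg (by positivity)]
      refine mul_le_mul_of_nonneg_left ?_ (by positivity)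
      have h2 : ‖(2 : ℝ) • A' x μ‖ ≤ 2 * (c * η⁻¹) := by
        rw [norm_smul, Real.norm_of_nonneg (by norm_num : (0 : ℝ) ≤ 2)]
        exact mul_le_mul_of_nonneg_left (hbd _ _) (by norm_num)
      calc ‖(2 : ℝ) • A' x μ - A' (x + e ν) μ - A' (x - e ν) μ‖
          ≤ ‖(2 : ℝ) • A' x μ - A' (x + e ν) μ‖ + ‖A' (x - e ν) μ‖ := norm_sub_le _ _
        _ ≤ (‖(2 : ℝ) • A' x μ‖ + ‖A' (x + e ν) μ‖) + ‖A' (x - e ν) μ‖ := by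
            gcongr
            exact norm_sub_le _ _
        _ ≤ 2 * (c * η⁻¹) + c * η⁻¹ + c * η⁻¹ := by linarith [h2, hbd (x + e ν) μ, hbd (x - e ν) μ]
    calc ∑ ν : Fin d, ‖(η ^ 2)⁻¹ • ((2 : ℝ) • A' x μ - A' (x + e ν) μ - A' (x - e ν) μ)‖
        ≤ ∑ ν : Fin d, (η ^ 2)⁻¹ * (2 * (c * η⁻¹) + c * η⁻¹ + c * η⁻¹) := Finset.sum_le_sum hterm
      _ = (d : ℝ) * ((η ^ 2)⁻¹ * (2 * (c * η⁻¹) + c * η⁻¹ + c * η⁻¹)) := by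
          rw [Finset.sum_const, Finset.card_univ, Fintype.card_fin, nsmul_eq_mul]
  -- Step 5: Hahn–Banach, member by member
  rw [← hK]
  refine ⟨msup_le hK0 fun j hj b hb => ?_, msup_le hK0 fun j hj t ht => ?_, msup_le hK0 fun j hj b hb => ?_,
    msup_le hK0 fun j hj b hb => ?_⟩
  · -- `|A′|₍₋₁₎`
    have hwpos : 0 < weight L η (-(1 : ℝ)) j := weight_pos hL hη _ j
    have key : ∀ f : StrongDual ℂ 𝔸, weight L η (-(1 : ℝ)) j * ‖f (A' b.1 b.2)‖ ≤ ‖f‖ * K := by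
      intro f
      have hBdd : Bdd L m η (-(1 : ℝ)) (fun j (b : Site d × Fin d) => SideTouches (Ω j) b.1 b.2)
          (fun b => f (A' b.1 b.2)) := by
        refine ⟨‖f‖ * c, fun j' hj' b' hb' => ?_⟩
        rw [hw1]
        calc (L : ℝ) ^ j' * η * ‖f (A' b'.1 b'.2)‖ ≤ (L : ℝ) ^ j' * η * (‖f‖ * (c * ((L : ℝ) ^ j' * η)⁻¹)) :=
              mul_le_mul_of_nonneg_left ((f.le_opNorm _).trans
                (mul_le_mul_of_nonneg_left (hWA j' hj' b'.1 b'.2 hb').2 (norm_nonneg _))) (hscale0 j')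
          _ = ‖f‖ * c := by field_simp
      exact (weight_mul_norm_le_msup hBdd hj hb).trans (hf f).1
    have hdual : ‖A' b.1 b.2‖ ≤ K * (weight L η (-(1 : ℝ)) j)⁻¹ := by
      refine NormedSpace.norm_le_dual_bound ℂ _ (by positivity) fun f => ?_
      have h1 : ‖f (A' b.1 b.2)‖ ≤ ‖f‖ * K / weight L η (-(1 : ℝ)) j := by
        rw [le_div_iff₀ hwpos, mul_comm]; exact key f
      calc ‖f (A' b.1 b.2)‖ ≤ ‖f‖ * K / weight L η (-(1 : ℝ)) j := h1
        _ = K * (weight L η (-(1 : ℝ)) j)⁻¹ * ‖f‖ := by ring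
    calc weight L η (-(1 : ℝ)) j * ‖A' b.1 b.2‖
        ≤ weight L η (-(1 : ℝ)) j * (K * (weight L η (-(1 : ℝ)) j)⁻¹) :=
          mul_le_mul_of_nonneg_left hdual hwpos.le
      _ = K := by field_simp
  · -- `|∇^η_1 A′|₍₋₂₎`
    have hwpos : 0 < weight L η (-(2 : ℝ)) j := weight_pos hL hη _ j
    have key : ∀ f : StrongDual ℂ 𝔸, weight L η (-(2 : ℝ)) j *
        ‖f (covDerivFwd η (1 : Site d → Fin d → 𝔸ˣ) t.1 (fun z => A' z t.2.1) t.2.2)‖ ≤ ‖f‖ * K := by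
      intro f
      have hBdd : Bdd L m η (-(2 : ℝ)) (fun j (t : Fin d × Fin d × Site d) => SideTouches (Ω j) t.2.2 t.2.1)
          (fun t => covDerivFwd η (1 : Site d → Fin d → ℂˣ) t.1 (fun z => f (A' z t.2.1)) t.2.2) := by
        refine ⟨((L : ℝ) ^ m * η) ^ 2 * (η⁻¹ * (‖f‖ * (c * η⁻¹) + ‖f‖ * (c * η⁻¹))), fun j' hj' t' _ => ?_⟩
        rw [hw2]
        have hfb : ∀ z, ‖f (A' z t'.2.1)‖ ≤ ‖f‖ * (c * η⁻¹) := fun z =>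
          (f.le_opNorm _).trans (mul_le_mul_of_nonneg_left (hbd z _) (norm_nonneg _))
        exact mul_le_mul (pow_le_pow_left₀ (hscale0 j') (hscale j' hj') 2) (norm_covDerivFwd_flat_le hη hfb _ _)
          (norm_nonneg _) (by positivity)
      have hD : covDerivFwd η (1 : Site d → Fin d → ℂˣ) t.1 (fun z => f (A' z t.2.1)) t.2.2 =
          f (covDerivFwd η (1 : Site d → Fin d → 𝔸ˣ) t.1 (fun z => A' z t.2.1) t.2.2) :=
        (map_covDerivFwd_flat f η t.1 (fun z => A' z t.2.1) t.2.2).symm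
      have h := weight_mul_norm_le_msup hBdd hj ht
      rw [hD] at h
      exact h.trans (hf f).2.1
    have hdual : ‖covDerivFwd η (1 : Site d → Fin d → 𝔸ˣ) t.1 (fun z => A' z t.2.1) t.2.2‖ ≤
        K * (weight L η (-(2 : ℝ)) j)⁻¹ := by
      refine NormedSpace.norm_le_dual_bound ℂ _ (by positivity) fun f => ?_
      have h1 : ‖f (covDerivFwd η (1 : Site d → Fin d → 𝔸ˣ) t.1 (fun z => A' z t.2.1) t.2.2)‖ ≤
          ‖f‖ * K / weight L η (-(2 : ℝ)) j := by
        rw [le_div_iff₀ hwpos, mul_comm]; exact key f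
      calc ‖f (covDerivFwd η (1 : Site d → Fin d → 𝔸ˣ) t.1 (fun z => A' z t.2.1) t.2.2)‖
          ≤ ‖f‖ * K / weight L η (-(2 : ℝ)) j := h1
        _ = K * (weight L η (-(2 : ℝ)) j)⁻¹ * ‖f‖ := by ring
    calc weight L η (-(2 : ℝ)) j * ‖covDerivFwd η (1 : Site d → Fin d → 𝔸ˣ) t.1 (fun z => A' z t.2.1) t.2.2‖
        ≤ weight L η (-(2 : ℝ)) j * (K * (weight L η (-(2 : ℝ)) j)⁻¹) :=
          mul_le_mul_of_nonneg_left hdual hwpos.le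
      _ = K := by field_simp

  · -- `|J(A′)|₍₋₃₎` (the current member; the tree's `Jcur` IS `pdiv ∘ plaqCovDeriv`)
    have hwpos : 0 < weight L η (-(3 : ℝ)) j := weight_pos hL hη _ j
    have key : ∀ f : StrongDual ℂ 𝔸, weight L η (-(3 : ℝ)) j *
        ‖f (Jcur η (1 : Site d → Fin d → 𝔸ˣ) A' b.2 b.1)‖ ≤ ‖f‖ * K := by
      intro f
      have hBdd : Bdd L m η (-(3 : ℝ)) (fun j (b : Site d × Fin d) => BondTouches (Ω j) b.1 b.2)
          (fun b => Jcur η (1 : Site d → Fin d → ℂˣ) (fun y τ => f (A' y τ)) b.2 b.1) := by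
        refine ⟨((L : ℝ) ^ m * η) ^ 3 * (‖f‖ * J₀), fun j' hj' b' _ => ?_⟩
        dsimp only
        rw [hw3, ← map_Jcur_flat f η A' b'.2 b'.1]
        exact mul_le_mul (pow_le_pow_left₀ (hscale0 j') (hscale j' hj') 3)
          ((f.le_opNorm _).trans (mul_le_mul_of_nonneg_left (hJbd _ _) (norm_nonneg _))) (norm_nonneg _) (by positivity)
      have h := weight_mul_norm_le_msup hBdd hj hb
      rw [← map_Jcur_flat f η A' b.2 b.1] at h
      exact h.trans (hf f).2.2.1
    have hdual : ‖Jcur η (1 : Site d → Fin d → 𝔸ˣ) A' b.2 b.1‖ ≤ K * (weight L η (-(3 : ℝ)) j)⁻¹ := by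
      refine NormedSpace.norm_le_dual_bound ℂ _ (by positivity) fun f => ?_
      have h1 : ‖f (Jcur η (1 : Site d → Fin d → 𝔸ˣ) A' b.2 b.1)‖ ≤ ‖f‖ * K / weight L η (-(3 : ℝ)) j := by
        rw [le_div_iff₀ hwpos, mul_comm]; exact key f
      calc ‖f (Jcur η (1 : Site d → Fin d → 𝔸ˣ) A' b.2 b.1)‖ ≤ ‖f‖ * K / weight L η (-(3 : ℝ)) j := h1
        _ = K * (weight L η (-(3 : ℝ)) j)⁻¹ * ‖f‖ := by ring
    calc weight L η (-(3 : ℝ)) j * ‖Jcur η (1 : Site d → Fin d → 𝔸ˣ) A' b.2 b.1‖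
        ≤ weight L η (-(3 : ℝ)) j * (K * (weight L η (-(3 : ℝ)) j)⁻¹) := mul_le_mul_of_nonneg_left hdual hwpos.le
      _ = K := by field_simp
  · -- `|ΔA′|₍₋₃₎` (the flat Laplacian of the components)
    have hwpos : 0 < weight L η (-(3 : ℝ)) j := weight_pos hL hη _ j
    have key : ∀ f : StrongDual ℂ 𝔸, weight L η (-(3 : ℝ)) j *
        ‖f (covLap η (1 : Site d → Fin d → 𝔸ˣ) (fun z => A' z b.2) b.1)‖ ≤ ‖f‖ * K := by
      intro f
      have hBdd : Bdd L m η (-(3 : ℝ)) (fun j (b : Site d × Fin d) => BondTouches (Ω j) b.1 b.2)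
          (fun b => covLap η (1 : Site d → Fin d → ℂˣ) (fun z => f (A' z b.2)) b.1) := by
        refine ⟨((L : ℝ) ^ m * η) ^ 3 * (‖f‖ * ((d : ℝ) * ((η ^ 2)⁻¹ * (2 * (c * η⁻¹) + c * η⁻¹ + c * η⁻¹)))),
          fun j' hj' b' _ => ?_⟩
        dsimp only
        rw [hw3, ← map_covLap_flat f η (fun z => A' z b'.2) b'.1]
        exact mul_le_mul (pow_le_pow_left₀ (hscale0 j') (hscale j' hj') 3)
          ((f.le_opNorm _).trans (mul_le_mul_of_nonneg_left (hLap _ _) (norm_nonneg _))) (norm_nonneg _) (by positivity)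
      have h := weight_mul_norm_le_msup hBdd hj hb
      rw [← map_covLap_flat f η (fun z => A' z b.2) b.1] at h
      exact h.trans (hf f).2.2.2
    have hdual : ‖covLap η (1 : Site d → Fin d → 𝔸ˣ) (fun z => A' z b.2) b.1‖ ≤ K * (weight L η (-(3 : ℝ)) j)⁻¹ := by
      refine NormedSpace.norm_le_dual_bound ℂ _ (by positivity) fun f => ?_
      have h1 : ‖f (covLap η (1 : Site d → Fin d → 𝔸ˣ) (fun z => A' z b.2) b.1)‖ ≤ ‖f‖ * K / weight L η (-(3 : ℝ)) j := by
        rw [le_div_iff₀ hwpos, mul_comm]; exact key f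
      calc ‖f (covLap η (1 : Site d → Fin d → 𝔸ˣ) (fun z => A' z b.2) b.1)‖ ≤ ‖f‖ * K / weight L η (-(3 : ℝ)) j := h1
        _ = K * (weight L η (-(3 : ℝ)) j)⁻¹ * ‖f‖ := by ring
    calc weight L η (-(3 : ℝ)) j * ‖covLap η (1 : Site d → Fin d → 𝔸ˣ) (fun z => A' z b.2) b.1‖
        ≤ weight L η (-(3 : ℝ)) j * (K * (weight L η (-(3 : ℝ)) j)⁻¹) := mul_le_mul_of_nonneg_left hdual hwpos.le
      _ = K := by field_simp

#print axioms flat159_clause4_of_scalar_bdry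

end Transfer

end Literature.MathematicalPhysics.QuantumFieldTheory.Balaban1983to89.B8Ineq159Flat4OfScalarBdry

end
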